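import Summits.BirchSwinnertonDyer.BirchSwinnertonDyer.Theorems.BiquadraticEisensteinDescentHeegnerTwistCouplingInSupplySymbolicMonskyTwoPrime
import Mathlib.Tactic.ReduceModChar
import HarnessLib

set_option linter.dupNamespace false -- `Summit.BirchSwinnertonDyer.BirchSwinnertonDyer.Theorems.…` (summit = sub)
set_option autoImplicit false

/-!
# Crux `HeegnerTwistCouplingInSupply` (stmt-BirchSwinnertonDyer-21381) — Z-DESIGNS with any number of free cells, part 1: bookkeeping and the
# four pattern-independent identities

Route `BiquadraticEisensteinDescent` (cell `pub/bsd-wall`, width seat `bsd-wall-cm-bed-w3` g22; `--supports` 21381, helper). Generalises the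
two-cell bookkeeping of `…SymbolicMonskyTwoPrimeRows` / `…TwoPrimeCore` (w3 g21, `[c₁, c₂]`) to the menu `c₁ :: rest` of the memo
PATTERN-FREE-STRUCTURE-w3g21 §1: ONE auxiliary prime `q₁ ≡ 3 (mod 4)` (cell `c₁`) and `τ = |rest|` FREE cells `q_{i+1} ≡ 1 (mod 4)` with
symbol vectors `σ_i` against the base and `(2/·)`-classes `d'_i`; Heegner forces `c₁`'s bits `= m + Σ σ_i` and `(2/·)`-class `Σ d'_i`.

* `sum_fin_cons`, `prod_clsVal_mod_eight`, `heegnerK_design` (the design passes the Heegner check);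
* the reference symbols: `bz_neg_aux_aux_design` (mutual symbols vanish), `bz_neg_head_castAdd` / `bz_neg_tail_castAdd` (`q₁` sees `Σσ_i`,
  `q_{i+1}` sees `σ_i`, in `𝔽₂`);
* ★ `design_identities`: for the reference matrix `M` of `(base, c₁ :: rest)` and ANY `z` killed by the base rows and by the two auxiliary
  row-sums, with `ũ = u_B + u(q₁)·1`, `w = u_B + v_B`, `a_i = u(q_{i+1}) + u(q₁)`, `e_i = w(q_{i+1}) + w(q₁)`, `c_i = |σ_i|`:
  `(L+D_m)ũ + D_d w = Σ_i a_i σ_i`, `D_m ũ + L w = (Σ_i c_i e_i)·m + Σ_i e_i σ_i`, `Σ_i (c_i a_i + d'_i e_i) = 0`, `v(q₁) = Σ_i c_i e_i`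
  (memo §1 equations (1′), (2′), (Σ3), (Σ4), now kernel-checked at general `k` and general `τ`).

HONEST FRAMING: bookkeeping over `𝔽₂`; the crux (C⁺), its registered stubs and BSD are untouched; nothing is closed. THEOREMS ONLY.
Reference: [HeathBrown1994] appendix (Monsky), typescript pp. 39–41.
-/

namespace Summit.BirchSwinnertonDyer.BirchSwinnertonDyer.Theorems.SymbolicMonsky

section DesignRows

open Matrix

variable {k : ℕ} (base : SymbData (k + 1)) (c₁ : AuxCell) (rest : List AuxCell)

/-! ### Index and list bookkeeping for `c₁ :: rest` -/

/-- Sums over the index type of `c₁ :: rest`: head plus tail. -/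
theorem sum_fin_cons (F : Fin (c₁ :: rest).length → ZMod 2) :
    (∑ j, F j) = F ⟨0, by simp⟩ + ∑ i : Fin rest.length, F ⟨i.val + 1, by simp⟩ := by
  show (∑ j : Fin (rest.length + 1), F j) = _
  rw [Fin.sum_univ_succ]
  rfl

/-- The head cell. -/
theorem getD_cons_head : (c₁ :: rest).getD (0 : ℕ) (0, 0) = c₁ := rfl

/-- The tail cells. -/
theorem getD_cons_tail (i : Fin rest.length) : (c₁ :: rest).getD (i.val + 1) (0, 0) = rest.getD i.val (0, 0) := rfl

/-- An index of `c₁ :: rest` is the head or a tail index. -/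
theorem fin_cons_cases (j : Fin (c₁ :: rest).length) :
    j = ⟨0, by simp⟩ ∨ ∃ i : Fin rest.length, j = ⟨i.val + 1, by simp⟩ := by
  rcases j with ⟨v, hv⟩
  rcases v with _ | v
  · exact Or.inl rfl
  · right
    have hv' : v < rest.length := by simpa using hv
    exact ⟨⟨v, hv'⟩, rfl⟩

/-- The product of odd classes mod `8` is read off the two parities `Σ[≡ 3 (4)]`, `Σ[(2/·) = −1]` (the group `(ℤ/8)ˣ ≅ 𝔽₂²`). -/
theorem prod_clsVal_mod_eight (l : List AuxCell) :
    (l.map fun c => clsVal c.1).prod % 8 =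
      (if xorFold l (fun c => negNegOne c.1) then (if xorFold l (fun c => negTwo c.1) then 3 else 7)
        else (if xorFold l (fun c => negTwo c.1) then 5 else 1)) := by
  induction l with
  | nil => simp [xorFold]
  | cons c l ih =>
    rw [List.map_cons, List.prod_cons, Nat.mul_mod, ih, xorFold_cons, xorFold_cons]
    clear ih
    rcases c with ⟨a, s⟩
    simp only
    generalize xorFold l (fun c => negNegOne c.1) = M
    generalize xorFold l (fun c => negTwo c.1) = D
    cases M <;> cases D <;> fin_cases a <;> rfl

/-- A sum of `bz`'s over the cells of a list, as the `xorFold` over the list. -/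
theorem sum_bz_getD_eq_xorFold (l : List AuxCell) (f : AuxCell → Bool) :
    (∑ i : Fin l.length, bz (f (l.getD i.val (0, 0)))) = bz (xorFold l f) := by
  rw [sum_univ_bz, xorFold_aux_eq l f]

/-- ★ The design passes the general-`k` Heegner check: one cell `≡ 3 (4)` whose bits are `m + Σσ_i` and whose `(2/·)`-class is `Σ d'_i`,
the others `≡ 1 (4)`. -/
theorem heegnerK_design (hm1 : negNegOne c₁.1 = true) (hmr : ∀ i : Fin rest.length, negNegOne (rest.getD i.val (0, 0)).1 = false)
    (hd1 : bz (negTwo c₁.1) = ∑ i : Fin rest.length, bz (negTwo (rest.getD i.val (0, 0)).1))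
    (hσ1 : ∀ b : Fin (k + 1), bz (c₁.2.testBit b.val) =
      bz (negNegOne (base.cls b)) + ∑ i : Fin rest.length, bz ((rest.getD i.val (0, 0)).2.testBit b.val)) :
    heegnerK base (c₁ :: rest) = true := by
  have hM : xorFold rest (fun c => negNegOne c.1) = false := by
    have e := sum_bz_getD_eq_xorFold rest (fun c => negNegOne c.1)
    rw [← bz_eq_zero_iff, ← e]
    exact Finset.sum_eq_zero fun i _ => by rw [hmr i]; rfl
  have hD : xorFold rest (fun c => negTwo c.1) = negTwo c₁.1 := by
    have e := sum_bz_getD_eq_xorFold rest (fun c => negTwo c.1)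
    have h := hd1
    rw [e] at h
    revert h
    cases negTwo c₁.1 <;> cases xorFold rest (fun c => negTwo c.1) <;> simp [bz]
  unfold heegnerK
  simp only [List.length_cons, Nat.zero_lt_succ, decide_true, Bool.true_and, Bool.and_eq_true, beq_iff_eq, List.all_eq_true,
    List.mem_finRange, true_implies]
  constructor
  · rw [prod_clsVal_mod_eight, xorFold_cons, xorFold_cons, hM, hD, hm1]
    cases negTwo c₁.1 <;> rfl
  · intro b
    rw [xorFold_cons]
    have h := hσ1 b
    have e := sum_bz_getD_eq_xorFold rest (fun c => c.2.testBit b.val)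
    rw [e] at h
    revert h
    cases c₁.2.testBit b.val <;> cases negNegOne (base.cls b) <;> cases xorFold rest (fun c => c.2.testBit b.val) <;> simp [bz]

/-! ### The reference symbols of the design -/

/-- The reference mutual symbols of `c₁ :: rest` vanish in `𝔽₂` against the weight `g j' + g j` (only `q₁` is `≡ 3 (4)`). -/
theorem sum_bz_neg_aux_aux_design (hmr : ∀ i : Fin rest.length, negNegOne (rest.getD i.val (0, 0)).1 = false)
    (g : Fin (c₁ :: rest).length → ZMod 2) (j : Fin (c₁ :: rest).length) :
    (∑ j' : Fin (c₁ :: rest).length, bz ((dataK base (c₁ :: rest) (fun _ _ => false)).neg (Fin.natAdd (k + 1) j)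
      (Fin.natAdd (k + 1) j')) * (g j' + g j)) = 0 := by
  refine Finset.sum_eq_zero fun j' _ => ?_
  by_cases hjj : j' = j
  · rw [hjj, zmod_two_add_self, mul_zero]
  · have hneg : (dataK base (c₁ :: rest) (fun _ _ => false)).neg (Fin.natAdd (k + 1) j) (Fin.natAdd (k + 1) j') = false := by
      unfold SymbData.neg
      by_cases hlt : Fin.natAdd (k + 1) j < Fin.natAdd (k + 1) j'
      · rw [if_pos hlt, RealisesK.dataK_up_natAdd_natAdd]
      · rw [if_neg hlt, RealisesK.dataK_up_natAdd_natAdd, RealisesK.dataK_cls_natAdd, RealisesK.dataK_cls_natAdd, Bool.false_xor]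
        rcases fin_cons_cases c₁ rest j with hj | ⟨i, hi⟩
        · rcases fin_cons_cases c₁ rest j' with hj' | ⟨i', hi'⟩
          · exact absurd (hj'.trans hj.symm) hjj
          · rw [hi']
            show (negNegOne ((c₁ :: rest).getD j.val (0, 0)).1 && negNegOne (rest.getD i'.val (0, 0)).1) = false
            rw [hmr i', Bool.and_false]
        · rw [hi]
          show (negNegOne (rest.getD i.val (0, 0)).1 && negNegOne ((c₁ :: rest).getD j'.val (0, 0)).1) = false
          rw [hmr i, Bool.false_and]
    rw [hneg]; simp [bz]

/-- The head cell sees `Σ_i σ_i` (in `𝔽₂`): `bz[(P_b/q₁) = −1] = bz(bits of c₁ at b) + m_b = Σ_i σ_i(b)`. -/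
theorem bz_neg_head_castAdd (hm1 : negNegOne c₁.1 = true) (σ : Fin rest.length → Fin (k + 1) → ZMod 2)
    (hσ1 : ∀ b : Fin (k + 1), bz (c₁.2.testBit b.val) = bz (negNegOne (base.cls b)) + ∑ i, σ i b)
    (pat : ℕ → ℕ → Bool) (b : Fin (k + 1)) :
    bz ((dataK base (c₁ :: rest) pat).neg (Fin.natAdd (k + 1) (⟨0, by simp⟩ : Fin (c₁ :: rest).length))
      (Fin.castAdd (c₁ :: rest).length b)) = ∑ i, σ i b := by
  rw [dataK_neg_natAdd_castAdd, bz_xor_add]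
  show bz (c₁.2.testBit b.val) + bz (negNegOne c₁.1 && negNegOne (base.cls b)) = _
  rw [hσ1 b, hm1, Bool.true_and]
  linear_combination (norm := skip) (zmod_two_add_self (bz (negNegOne (base.cls b))))
  ring_nf

/-- A tail cell sees its own `σ_i`: `bz[(P_b/q_{i+1}) = −1] = σ_i(b)`. -/
theorem bz_neg_tail_castAdd (hmr : ∀ i : Fin rest.length, negNegOne (rest.getD i.val (0, 0)).1 = false)
    (σ : Fin rest.length → Fin (k + 1) → ZMod 2) (hσ : ∀ i b, bz ((rest.getD i.val (0, 0)).2.testBit b.val) = σ i b)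
    (pat : ℕ → ℕ → Bool) (i : Fin rest.length) (b : Fin (k + 1)) :
    bz ((dataK base (c₁ :: rest) pat).neg (Fin.natAdd (k + 1) (⟨i.val + 1, by simp⟩ : Fin (c₁ :: rest).length))
      (Fin.castAdd (c₁ :: rest).length b)) = σ i b := by
  rw [dataK_neg_natAdd_castAdd]
  show bz (xor ((rest.getD i.val (0, 0)).2.testBit b.val) (negNegOne (rest.getD i.val (0, 0)).1 && negNegOne (base.cls b))) = _
  rw [hmr i, Bool.false_and, Bool.xor_false, hσ]

/-! ### Small `𝔽₂` sum manipulations -/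

/-- `Σ_i s_i (X_i + y) = Σ_i s_i X_i + (Σ_i s_i) y`. -/
theorem sum_mul_add_const {n : ℕ} (s X : Fin n → ZMod 2) (y : ZMod 2) :
    (∑ i, s i * (X i + y)) = (∑ i, s i * X i) + (∑ i, s i) * y := by
  rw [Finset.sum_mul, ← Finset.sum_add_distrib]
  exact Finset.sum_congr rfl fun i _ => by ring

/-- Swapping a double sum: `Σ_b (Σ_i σ_i b) p_b = Σ_i Σ_b σ_i b p_b`. -/
theorem sum_sum_mul_swap {n m : ℕ} (σ : Fin n → Fin m → ZMod 2) (p : Fin m → ZMod 2) :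
    (∑ b, (∑ i, σ i b) * p b) = ∑ i, ∑ b, σ i b * p b := by
  rw [Finset.sum_comm]
  exact Finset.sum_congr rfl fun b _ => by rw [Finset.sum_mul]

/-! ### ★ The four pattern-independent identities of a design -/

/-- ★ **Design identities** (memo PATTERN-FREE-STRUCTURE §1: (1′), (2′), (Σ3), (Σ4), general `k`, general `τ`). For the reference matrix of
`(base, c₁ :: rest)` and any `z` whose base rows and both auxiliary row-sums vanish: with `u_b, v_b` the base coordinates,
`U₀, V₀` those of `q₁`, `U_i, V_i` those of `q_{i+1}`, `ũ = u + U₀`, `w = u + v`, `a_i = U_i + U₀`, `e_i = (U_i+V_i) + (U₀+V₀)`,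
`c_i = Σ_b σ_i(b)`:
(D1) `(L + D_m)ũ + D_d w = Σ_i a_i σ_i`; (D2) `D_m ũ + L w = (Σ_i c_i e_i) m + Σ_i e_i σ_i`; (D3) `Σ_i (c_i a_i + d'_i e_i) = 0`;
(D4) `V₀ = Σ_i c_i e_i`. [cite: HeathBrown1994SelmerCongruentII, Appendix (Monsky), typescript p. 39 L27–L33] -/
theorem design_identities (hm1 : negNegOne c₁.1 = true) (hmr : ∀ i : Fin rest.length, negNegOne (rest.getD i.val (0, 0)).1 = false)
    (σ : Fin rest.length → Fin (k + 1) → ZMod 2) (hσ : ∀ i b, bz ((rest.getD i.val (0, 0)).2.testBit b.val) = σ i b)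
    (hσ1 : ∀ b : Fin (k + 1), bz (c₁.2.testBit b.val) = bz (negNegOne (base.cls b)) + ∑ i, σ i b)
    (dp : Fin rest.length → ZMod 2) (hdp : ∀ i, bz (negTwo (rest.getD i.val (0, 0)).1) = dp i)
    (hd1 : bz (negTwo c₁.1) = ∑ i, dp i)
    (z : Fin (k + 1 + (c₁ :: rest).length) ⊕ Fin (k + 1 + (c₁ :: rest).length) → ZMod 2)
    (hrow1 : ∀ b : Fin (k + 1), ((dataK base (c₁ :: rest) (fun _ _ => false)).monskyOddS *ᵥ z) (Sum.inl (Fin.castAdd _ b)) = 0)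
    (hrow2 : ∀ b : Fin (k + 1), ((dataK base (c₁ :: rest) (fun _ _ => false)).monskyOddS *ᵥ z) (Sum.inr (Fin.castAdd _ b)) = 0)
    (hs1 : (∑ j : Fin (c₁ :: rest).length,
      ((dataK base (c₁ :: rest) (fun _ _ => false)).monskyOddS *ᵥ z) (Sum.inl (Fin.natAdd (k + 1) j))) = 0)
    (hs2 : (∑ j : Fin (c₁ :: rest).length,
      ((dataK base (c₁ :: rest) (fun _ _ => false)).monskyOddS *ᵥ z) (Sum.inr (Fin.natAdd (k + 1) j))) = 0) :
    (∀ b : Fin (k + 1),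
      (∑ b', bz (base.neg b b') * ((z (Sum.inl (Fin.castAdd _ b')) + z (Sum.inl (Fin.natAdd (k + 1) (⟨0, by simp⟩ : Fin (c₁ :: rest).length)))) +
        (z (Sum.inl (Fin.castAdd _ b)) + z (Sum.inl (Fin.natAdd (k + 1) (⟨0, by simp⟩ : Fin (c₁ :: rest).length)))))) +
      bz (negNegOne (base.cls b)) * (z (Sum.inl (Fin.castAdd _ b)) + z (Sum.inl (Fin.natAdd (k + 1) (⟨0, by simp⟩ : Fin (c₁ :: rest).length)))) +
      bz (negTwo (base.cls b)) * (z (Sum.inl (Fin.castAdd _ b)) + z (Sum.inr (Fin.castAdd _ b))) =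
      ∑ i : Fin rest.length, σ i b * (z (Sum.inl (Fin.natAdd (k + 1) (⟨i.val + 1, by simp⟩ : Fin (c₁ :: rest).length))) +
        z (Sum.inl (Fin.natAdd (k + 1) (⟨0, by simp⟩ : Fin (c₁ :: rest).length))))) ∧
    (∀ b : Fin (k + 1),
      bz (negNegOne (base.cls b)) * (z (Sum.inl (Fin.castAdd _ b)) + z (Sum.inl (Fin.natAdd (k + 1) (⟨0, by simp⟩ : Fin (c₁ :: rest).length)))) +
      (∑ b', bz (base.neg b b') * ((z (Sum.inl (Fin.castAdd _ b')) + z (Sum.inr (Fin.castAdd _ b'))) +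
        (z (Sum.inl (Fin.castAdd _ b)) + z (Sum.inr (Fin.castAdd _ b))))) =
      (∑ i : Fin rest.length, (∑ b', σ i b') *
        ((z (Sum.inl (Fin.natAdd (k + 1) (⟨i.val + 1, by simp⟩ : Fin (c₁ :: rest).length))) +
          z (Sum.inr (Fin.natAdd (k + 1) (⟨i.val + 1, by simp⟩ : Fin (c₁ :: rest).length)))) +
         (z (Sum.inl (Fin.natAdd (k + 1) (⟨0, by simp⟩ : Fin (c₁ :: rest).length))) +
          z (Sum.inr (Fin.natAdd (k + 1) (⟨0, by simp⟩ : Fin (c₁ :: rest).length)))))) * bz (negNegOne (base.cls b)) +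
      ∑ i : Fin rest.length, σ i b *
        ((z (Sum.inl (Fin.natAdd (k + 1) (⟨i.val + 1, by simp⟩ : Fin (c₁ :: rest).length))) +
          z (Sum.inr (Fin.natAdd (k + 1) (⟨i.val + 1, by simp⟩ : Fin (c₁ :: rest).length)))) +
         (z (Sum.inl (Fin.natAdd (k + 1) (⟨0, by simp⟩ : Fin (c₁ :: rest).length))) +
          z (Sum.inr (Fin.natAdd (k + 1) (⟨0, by simp⟩ : Fin (c₁ :: rest).length)))))) ∧
    (∑ i : Fin rest.length, ((∑ b', σ i b') *
        (z (Sum.inl (Fin.natAdd (k + 1) (⟨i.val + 1, by simp⟩ : Fin (c₁ :: rest).length))) +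
          z (Sum.inl (Fin.natAdd (k + 1) (⟨0, by simp⟩ : Fin (c₁ :: rest).length)))) +
      dp i * ((z (Sum.inl (Fin.natAdd (k + 1) (⟨i.val + 1, by simp⟩ : Fin (c₁ :: rest).length))) +
          z (Sum.inr (Fin.natAdd (k + 1) (⟨i.val + 1, by simp⟩ : Fin (c₁ :: rest).length)))) +
         (z (Sum.inl (Fin.natAdd (k + 1) (⟨0, by simp⟩ : Fin (c₁ :: rest).length))) +
          z (Sum.inr (Fin.natAdd (k + 1) (⟨0, by simp⟩ : Fin (c₁ :: rest).length))))))) = 0 ∧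
    z (Sum.inr (Fin.natAdd (k + 1) (⟨0, by simp⟩ : Fin (c₁ :: rest).length))) =
      ∑ i : Fin rest.length, (∑ b', σ i b') *
        ((z (Sum.inl (Fin.natAdd (k + 1) (⟨i.val + 1, by simp⟩ : Fin (c₁ :: rest).length))) +
          z (Sum.inr (Fin.natAdd (k + 1) (⟨i.val + 1, by simp⟩ : Fin (c₁ :: rest).length)))) +
         (z (Sum.inl (Fin.natAdd (k + 1) (⟨0, by simp⟩ : Fin (c₁ :: rest).length))) +
          z (Sum.inr (Fin.natAdd (k + 1) (⟨0, by simp⟩ : Fin (c₁ :: rest).length))))) := by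
  -- names
  set q0 : Fin (c₁ :: rest).length := ⟨0, by simp⟩ with hq0
  set U0 := z (Sum.inl (Fin.natAdd (k + 1) q0)) with hU0
  set V0 := z (Sum.inr (Fin.natAdd (k + 1) q0)) with hV0
  set U : Fin rest.length → ZMod 2 := fun i => z (Sum.inl (Fin.natAdd (k + 1) (⟨i.val + 1, by simp⟩ : Fin (c₁ :: rest).length))) with hU
  set V : Fin rest.length → ZMod 2 := fun i => z (Sum.inr (Fin.natAdd (k + 1) (⟨i.val + 1, by simp⟩ : Fin (c₁ :: rest).length))) with hV
  set u : Fin (k + 1) → ZMod 2 := fun b => z (Sum.inl (Fin.castAdd (c₁ :: rest).length b)) with hu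
  set v : Fin (k + 1) → ZMod 2 := fun b => z (Sum.inr (Fin.castAdd (c₁ :: rest).length b)) with hv
  -- cell data of the list
  have cls0 : ((c₁ :: rest).getD (q0 : ℕ) (0, 0)) = c₁ := rfl
  have clsS : ∀ i : Fin rest.length, ((c₁ :: rest).getD ((⟨i.val + 1, by simp⟩ : Fin (c₁ :: rest).length) : ℕ) (0, 0)) =
      rest.getD i.val (0, 0) := fun i => rfl
  have hN2head : bz (negNegTwo c₁.1) = (∑ i, dp i) + 1 := by
    have h := bz_negNegOne_add_bz_negNegTwo c₁.1
    rw [hm1, hd1] at h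
    have h1 : bz true = (1 : ZMod 2) := rfl
    rw [h1] at h
    linear_combination (norm := skip) h
    ring_nf
    try reduce_mod_char
  have hN2tail : ∀ i : Fin rest.length, bz (negNegTwo (rest.getD i.val (0, 0)).1) = dp i := by
    intro i
    have h := bz_negNegOne_add_bz_negNegTwo (rest.getD i.val (0, 0)).1
    rw [hmr i, hdp i] at h
    have h0 : bz false = (0 : ZMod 2) := rfl
    rw [h0, zero_add] at h
    exact h
  -- base rows
  have R1 : ∀ b : Fin (k + 1), (∑ b', bz (base.neg b b') * (u b' + u b)) +
      ((bz (negNegOne (base.cls b)) + ∑ i, σ i b) * (U0 + u b) + ∑ i, σ i b * (U i + u b)) +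
      bz (negTwo (base.cls b)) * (u b + v b) = 0 := by
    intro b
    have h := hrow1 b
    rw [mulVec_inl_castAdd_expand, sum_fin_cons] at h
    simp only [List.getD_cons_zero, List.getD_cons_succ, hσ1, hσ] at h
    exact h
  have R2 : ∀ b : Fin (k + 1), bz (negTwo (base.cls b)) * u b +
      ((∑ b', bz (base.neg b b') * (v b' + v b)) +
       ((bz (negNegOne (base.cls b)) + ∑ i, σ i b) * (V0 + v b) + ∑ i, σ i b * (V i + v b))) +
      bz (negNegTwo (base.cls b)) * v b = 0 := by
    intro b
    have h := hrow2 b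
    rw [mulVec_inr_castAdd_expand, sum_fin_cons] at h
    simp only [List.getD_cons_zero, List.getD_cons_succ, hσ1, hσ] at h
    exact h
  -- auxiliary row sums
  have S1 : (∑ b, (∑ i, σ i b) * (u b + U0)) + (∑ i, dp i) * (U0 + V0) +
      ∑ i, ((∑ b, σ i b * (u b + U i)) + dp i * (U i + V i)) = 0 := by
    have h := hs1
    rw [sum_fin_cons, mulVec_inl_natAdd_expand] at h
    simp only [mulVec_inl_natAdd_expand, sum_bz_neg_aux_aux_design base c₁ rest hmr, add_zero,
      bz_neg_head_castAdd base c₁ rest hm1 σ hσ1, bz_neg_tail_castAdd base c₁ rest hmr σ hσ,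
      List.getD_cons_zero, List.getD_cons_succ, hd1, hdp] at h
    exact h
  have S2 : (∑ i, dp i) * U0 + (∑ b, (∑ i, σ i b) * (v b + V0)) + ((∑ i, dp i) + 1) * V0 +
      ∑ i, (dp i * U i + (∑ b, σ i b * (v b + V i)) + dp i * V i) = 0 := by
    have h := hs2
    rw [sum_fin_cons, mulVec_inr_natAdd_expand] at h
    simp only [mulVec_inr_natAdd_expand, sum_bz_neg_aux_aux_design base c₁ rest hmr, add_zero,
      bz_neg_head_castAdd base c₁ rest hm1 σ hσ1, bz_neg_tail_castAdd base c₁ rest hmr σ hσ,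
      List.getD_cons_zero, List.getD_cons_succ, hd1, hdp, hN2head, hN2tail] at h
    exact h
  -- normalise the four facts: swap the double sums, distribute
  rw [sum_sum_mul_swap] at S1 S2
  simp only [mul_add, add_mul, Finset.sum_add_distrib, ← Finset.sum_mul] at R1 R2 S1 S2
  have hmd : ∀ b : Fin (k + 1), bz (negNegOne (base.cls b)) + bz (negNegTwo (base.cls b)) = bz (negTwo (base.cls b)) :=
    fun b => bz_negNegOne_add_bz_negNegTwo (base.cls b)
  -- (D3)
  have D3 : (∑ i, ((∑ b', σ i b') * (U i + U0) + dp i * ((U i + V i) + (U0 + V0)))) = 0 := by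
    simp only [mul_add, Finset.sum_add_distrib, ← Finset.sum_mul]
    linear_combination (norm := skip) S1
    ring_nf
    try reduce_mod_char
  -- (D4)
  have D4 : V0 = ∑ i, (∑ b', σ i b') * ((U i + V i) + (U0 + V0)) := by
    have D3' := D3
    simp only [mul_add, Finset.sum_add_distrib, ← Finset.sum_mul] at D3' ⊢
    linear_combination (norm := skip) S2 + D3'
    ring_nf
    try reduce_mod_char
  -- (D1)
  have D1 : ∀ b : Fin (k + 1), (∑ b', bz (base.neg b b') * ((u b' + U0) + (u b + U0))) +
      bz (negNegOne (base.cls b)) * (u b + U0) + bz (negTwo (base.cls b)) * (u b + v b) = ∑ i, σ i b * (U i + U0) := by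
    intro b
    rw [sum_neg_shift base b u U0]
    have R1b := R1 b
    simp only [mul_add, Finset.sum_add_distrib, ← Finset.sum_mul] at R1b ⊢
    linear_combination (norm := skip) R1b
    ring_nf
    try reduce_mod_char
  -- (D2)
  have D2 : ∀ b : Fin (k + 1), bz (negNegOne (base.cls b)) * (u b + U0) + (∑ b', bz (base.neg b b') * ((u b' + v b') + (u b + v b))) =
      (∑ i, (∑ b', σ i b') * ((U i + V i) + (U0 + V0))) * bz (negNegOne (base.cls b)) + ∑ i, σ i b * ((U i + V i) + (U0 + V0)) := by
    intro b
    rw [sum_neg_add base b u v]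
    have R1b := R1 b
    have R2b := R2 b
    have D4' := D4
    simp only [mul_add, add_mul, Finset.sum_add_distrib, ← Finset.sum_mul] at R1b R2b D4' ⊢
    linear_combination (norm := skip) R1b + R2b + v b * hmd b + bz (negNegOne (base.cls b)) * D4'
    ring_nf
    try reduce_mod_char
  exact ⟨D1, D2, D3, D4⟩

end DesignRows

end Summit.BirchSwinnertonDyer.BirchSwinnertonDyer.Theorems.SymbolicMonsky
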